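import Summits.CriticalPhenomena.PercolationContinuityZ3.Theorems.Transplant.TwoAxisParaCellsFineRep
import Summits.CriticalPhenomena.PercolationContinuityZ3.Theorems.Transplant.SkelPhiCellsWeakGQ
import HarnessLib

/-!
# Quasi-step rung (N3-b), BINDER WAVE, row «TwoAxisParaCellsFineRep» of WAVE-Q-MANIFEST v0.5 (rows TSV) under (ι) := `Skelφ.QStepsN G φ M`: the FINE-CELL
# representative vertex and the COLUMN POINT `hcol` of `sepGeomSG₂` for the fine cell map — the `×M` twins of «TwoAxisParaCellsFineRep» §2
# `exists_mem_graphBall_fineSkel_eq` / `hcol_fineSkel` (which assumed `Steps G φ`)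

builds on p205010 (kernel theorem, internal audit signed; external expert review pending) — nothing in this file uses p205010; nothing here is a claim about any open node
((N3-b), the end state); no carrier, no node, no definition.  Lane `prim-bschramm`, seat `prim-hp-8` (gen 62; binder-wave pen, pilot family P1 — lane INBOX 2026-08-27 07:25Z).
Helper file (`--supports stmt-CriticalPhenomena-4575 --as helper`).
WHY (hunk classes of the captain's pilot «SkelPhiParaRunStepsQ»: (i) binder, (iv) radius ×M; plus the β4 call-site swap).  The tree file takes `hstep : Steps G φ` (a) to call the
LEVEL-0 primitive `exists_mem_graphBall_φ_eq` (radius `‖rep₂ z‖₁`) — under the rung's currency the call is `Skelφ.QStepsN.exists_mem_graphBall_eq hq` (radius `M·‖rep₂ z‖₁`) —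
and (b) to get the weak steps of the fine cell map (`weakSteps_fineSkel`) — now gen-1 g4's `weakSteps_fineSkel_of_qStepsN` («SkelPhiCellsWeakGQ», p506284; adjacent neighbour,
no cost).  So the binder becomes `{M} (hq : QStepsN G φ M)`, the ONE radius of `exists_mem_graphBall_fineSkel_eq` is multiplied by `M`, and the `Nrep`/`colQ` FLOOR of
`hcol_fineSkel` reads `M·‖rep₂ (cen x)‖₁ + 1 ≤ R` (room for the M-link to the representative plus one weak step); proofs otherwise byte-identical.
Regression: `qStepsN_of_steps`, `M = 1` (`one_mul`).
* **`exists_mem_graphBall_fineSkel_eq_q`**, **`hcol_fineSkel_q`** (FLOOR ×M: `hR`).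
[cite: KozmaNitzan2024, §4 Lemma 10 Step IV (pp. 20–21), p. 26 ((29): columns)] [cite: MartineauTassion2017, §4.3 (boxes on the lattice z₁u + z₂v)]
-/

noncomputable section

namespace Summit.CriticalPhenomena.PercolationContinuityZ3.Theorems.Transplant

namespace Skelφ

open Literature.Probability.Percolation Literature.Probability.LatticeModels SimpleGraph
open Literature.Probability.Percolation.KozmaNitzan.Cells (oth)
open Literature.Barriers.CriticalPhenomena (graphBall mem_graphBall_self graphBall_mono)
open TwoAxis.Para (coarse lam0 lam1 detD rep₂)

variable {V : Type} [DecidableEq V] {G : SimpleGraph V} [G.LocallyFinite] {φ : V → Site 2}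

omit [DecidableEq V] [G.LocallyFinite] in
/-- **FINE QUASI-STEPS**: from `t`, a vertex at graph distance `≤ M·‖rep₂ z‖₁` whose fine-cell position is exactly `z` (under `QStepsN G φ M` and the room
`c_i·L_i + 2 ≤ D`, offsets `D/2`) — the `×M` twin of `exists_mem_graphBall_fineSkel_eq`. [cite: KozmaNitzan2024, §4 Lemma 10 Step IV (pp. 20–21)] -/
theorem exists_mem_graphBall_fineSkel_eq_q {M : ℕ} (hq : QStepsN G φ M) (t : V) {A n h vα vβ c₀ c₁ : ℤ} (hc₀ : 0 < c₀) (hc₁ : 0 < c₁)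
    (hD : 0 < detD A n h vα vβ) (hL0 : c₀ * (|A| * (|vβ| + |vα|)) + 2 ≤ detD A n h vα vβ)
    (hL1 : c₁ * (|A| * (|n| + |h|)) + 2 ≤ detD A n h vα vβ) (z : Site 2) :
    ∃ g, g ∈ graphBall G t (M * ((rep₂ A n h vα vβ c₀ c₁ z 0).natAbs + (rep₂ A n h vα vβ c₀ c₁ z 1).natAbs)) ∧
      fineSkel φ t A n h vα vβ c₀ c₁ (detD A n h vα vβ / 2) (detD A n h vα vβ / 2) (detD A n h vα vβ) g = z := by
  obtain ⟨g, hg, hφ⟩ := QStepsN.exists_mem_graphBall_eq hq t (φ t + rep₂ A n h vα vβ c₀ c₁ z)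
  refine ⟨g, ?_, ?_⟩
  · simpa using hg
  · have hrel : relφ φ t g = rep₂ A n h vα vβ c₀ c₁ z := by
      funext i; simp [relφ, hφ]
    obtain ⟨h0, h1⟩ := TwoAxis.Para.fine_rep hc₀ hc₁ hD hL0 hL1 z
    funext i
    fin_cases i
    · show fineSkel φ t A n h vα vβ c₀ c₁ (detD A n h vα vβ / 2) (detD A n h vα vβ / 2) (detD A n h vα vβ) g 0 = z 0
      rw [fineSkel_apply_zero, hrel]; exact h0
    · show fineSkel φ t A n h vα vβ c₀ c₁ (detD A n h vα vβ / 2) (detD A n h vα vβ / 2) (detD A n h vα vβ) g 1 = z 1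
      rw [fineSkel_apply_one, hrel]; exact h1

/-- **THE COLUMN POINT `hcol` of `sepGeomSG₂` for the fine cell map, under quasi-steps**: for every cube `Q x` there is a vertex of fine position exactly `cen x`
inside the window span `VWin (Q x) R`, as soon as `R ≥ M·‖rep₂ (cen x)‖₁ + 1` (room for the `M`-links to the representative and one weak step) — the `Nrep`/`colQ` slot
of the schedule, FLOOR `×M`; the `×M` twin of `hcol_fineSkel`. [cite: KozmaNitzan2024, §4 p. 26 ((29): columns)] -/
theorem hcol_fineSkel_q (hlip : Lip G φ) {M : ℕ} (hq : QStepsN G φ M) (t : V) {A n h vα vβ c₀ c₁ : ℤ} (hc₀ : 0 < c₀) (hc₁ : 0 < c₁)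
    (hD : 0 < detD A n h vα vβ) (hL0 : c₀ * (|A| * (|vβ| + |vα|)) + 2 ≤ detD A n h vα vβ)
    (hL1 : c₁ * (|A| * (|n| + |h|)) + 2 ≤ detD A n h vα vβ) (P : PCells2) (x : Site 2) {R : ℕ}
    (hR : M * ((rep₂ A n h vα vβ c₀ c₁ (P.cen x) 0).natAbs + (rep₂ A n h vα vβ c₀ c₁ (P.cen x) 1).natAbs) + 1 ≤ R) :
    ∃ y ∈ VWin G (fineSkel φ t A n h vα vβ c₀ c₁ (detD A n h vα vβ / 2) (detD A n h vα vβ / 2) (detD A n h vα vβ)) t (P.Q x) R,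
      fineSkel φ t A n h vα vβ c₀ c₁ (detD A n h vα vβ / 2) (detD A n h vα vβ / 2) (detD A n h vα vβ) y = P.cen x := by
  obtain ⟨g, hg, hgz⟩ := exists_mem_graphBall_fineSkel_eq_q hq t hc₀ hc₁ hD hL0 hL1 (P.cen x)
  have hlipψ : Lip G (fineSkel φ t A n h vα vβ c₀ c₁ (detD A n h vα vβ / 2) (detD A n h vα vβ / 2) (detD A n h vα vβ)) :=
    lip_fineSkel hlip t hc₀.le hc₁.le hD (by linarith) (by linarith)
  -- a weak-step neighbour stays in the cube `Q x` (its centre ± 1)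
  obtain ⟨m, hadj, -⟩ := weakSteps_fineSkel_of_qStepsN hq t hD hc₀.le hc₁.le (A := A) (n := n) (h := h) (vα := vα) (vβ := vβ)
    (s₀ := detD A n h vα vβ / 2) (s₁ := detD A n h vα vβ / 2) g 0 1
  have hQ : ∀ s : Site 2, (∀ i, |s i - P.cen x i| ≤ 1) → s ∈ P.Q x := fun s hs => by
    rw [PCells2.Q, PCells2.mem_abox_iff]
    intro i
    have := abs_le.1 (hs i); have := P.one_le_r i
    push_cast; constructor <;> omega
  have hgQ : fineSkel φ t A n h vα vβ c₀ c₁ (detD A n h vα vβ / 2) (detD A n h vα vβ / 2) (detD A n h vα vβ) g ∈ P.Q x :=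
    hQ _ fun i => by rw [hgz]; simp
  have hmQ : fineSkel φ t A n h vα vβ c₀ c₁ (detD A n h vα vβ / 2) (detD A n h vα vβ / 2) (detD A n h vα vβ) m ∈ P.Q x :=
    hQ _ fun i => by
      have := hlipψ hadj i
      rw [hgz] at this
      rw [abs_sub_comm]; exact this
  exact ⟨g, mem_VWin_of_adj hg hR hgQ hadj hmQ, hgz⟩

end Skelφ

end Summit.CriticalPhenomena.PercolationContinuityZ3.Theorems.Transplant

end
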